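import Summits.BirchSwinnertonDyer.BirchSwinnertonDyer.Theorems.SignedLowerHalvesSmallImageLowerHalfBothSignsRttCharRoadE1LocalAtP
import HarnessLib

/-!
# Route `SignedLowerHalves`, crux L `SmallImageLowerHalfBothSigns` (stmt-BirchSwinnertonDyer-23599), line `rtt_w3` v11 — brick D3-W AT `p` FOR THE
# CORESTRICTION: the local crossed homomorphism of `cor ξ` on `Λ'_n` IS the Kummer cocycle of the quadratic trace `Q + cQ`, and hence
# (with `…E1LocalAtP`) `cor ξ` satisfies Kobayashi's Kummer condition at `ι` from `E^ε(k_n·E)` (memo `Lines/rtt_w3-MEMO-D3c-w3g17.md` §7).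

Width seat `bsd-line-slh-p3-w3` g17 under LEAD `cruxlead-stmt-BirchSwinnertonDyer-23599` (cell `bsd-ssimc`; `--supports stmt-BirchSwinnertonDyer-23599 --as helper`).
THEOREMS ONLY (no definition, no named fact, no instance, no `sorry`); the corestriction is the tree's explicit index-`2` transfer
`Literature/…/H1CorestrictionIndexTwo` (`corCocycle`, `(cor f)(n) = f(n) + c₀·f(c₀⁻¹ n c₀)` on `N`, `corH1_oneCocycleClass`). BSD / crux L / INJ are NOT
proved here.

SETTING (§1, generic). `H, U ≤ Γ_k` (`H = Γ_{k_n}`, `U = galRange K`), `N = U.subgroupOf H ≤ H` normal and open, `M = E[p^∞]` with continuous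
`H`-orbits; a `k`-embedding `ι : k̄ → Ē`; `c ∈ Λ = localSubgroupOfEmb H ι` whose restriction `c₀ = res_ι c ∈ H` is the transversal: `H = N ⊔ N c₀`
(`hc`, the `Xor` of the tree — from `res_ι c ∉ U` and `[Γ_k : U] = 2`, `xor_mem_subgroupOf_of_index_two`). For `τ` in `Λ' = localSubgroupOfEmb (H ⊓ U) ι`
the element `res_ι τ` lies in `N`.
* `resGalSubgroupOfEmb_mem_subgroupOf`, `xor_mem_subgroupOf_of_index_two` — bookkeeping.
* ★ `pointsMapOfEmb_corCocycle_apply` — if on `Λ'` the local crossed homomorphism of `ξ ∈ Z¹(N, E[p^∞])` is the Kummer cocycle `τ ↦ τQ − Q`, then on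
  `Λ'` that of `corCocycle ξ ∈ Z¹(H, E[p^∞])` is `τ ↦ τ(Q + cQ) − (Q + cQ)` (`c₀·((c⁻¹τc)Q − Q) = τ(cQ) − cQ` through `pointsMapOfEmb_smul`).
* `nsmul_corCocycle_apply_eq_zero` — `p^a` kills the values of `corCocycle ξ` when it kills those of `ξ`.
§2 (the layers). ★★ `mem_localKummerOverOfEmb_signed_corCocycle` — `H = κ.layerSubgroup n`, `U = galRange K` of index `2`, the local square of
`…E1LocalSquare*`, `Q = transportPoints Q_K` with `p^{k'}Q_K ∈ E^ε(K_n·E')`: `[corCocycle ξ] ∈ localKummerOverOfEmb W p Γ_{k_n} ι (E^ε(k_n·E))`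
(★ + `…E1LocalAtP.mem_localKummerOverOfEmb_signed_of_kummer_trace_witness`); `corH1_mem_localKummerOverOfEmb_signed` — the same for the class
`corH1 [ξ]`.

References: [SerreGaloisCohomology1997] I §2.4, I §5.8; [NeukirchSchmidtWingberg2008] I §5 (corestriction on cochains); [Kobayashi2003] Def. 1.1.
-/

set_option autoImplicit false
set_option linter.dupNamespace false -- D-0017: single-problem summit, the namespace repeats the problem name by design
noncomputable section

open scoped Classical

universe u

namespace Summit.BirchSwinnertonDyer.BirchSwinnertonDyer.Theorems.SmallImageCharSignedSelmer

open Literature.NumberTheory.EllipticCurves Literature.NumberTheory.GaloisRepresentations Field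
  Summit.BirchSwinnertonDyer.Rank1Residual.Additive.LocalTransport

/-! ## §1 The local crossed homomorphism of the transfer -/

section CorLocal

variable {k : Type u} [Field k] (W : WeierstrassCurve k) (p : ℕ) (H U : Subgroup (absoluteGaloisGroup k))
  {E : Type u} [Field E] [Algebra k E] (ι : AlgebraicClosure k →ₐ[k] AlgebraicClosure E)

/-- For `τ ∈ Λ' = localSubgroupOfEmb (H ⊓ U) ι`, `res_ι τ ∈ N = U.subgroupOf H`. [cite: SerreGaloisCohomology1997, II §1.1] -/
theorem resGalSubgroupOfEmb_mem_subgroupOf {τ : absoluteGaloisGroup E} (hτ : τ ∈ localSubgroupOfEmb (H ⊓ U) ι) :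
    resGalSubgroupOfEmb H ι ⟨τ, localSubgroupOfEmb_inf_le H U ι hτ⟩ ∈ U.subgroupOf H := by
  rw [Subgroup.mem_subgroupOf, resGalSubgroupOfEmb_apply_coe]
  exact ((mem_localSubgroupOfEmb_inf_iff τ).1 hτ).2

/-- **The transversal condition** `H = N ⊔ N c₀` (the tree's `Xor`) for `N = U.subgroupOf H`, `U` of index `2`, `c₀ = res_ι c ∉ U`.
[cite: SerreGaloisCohomology1997, I §2.6 (b)] -/
theorem xor_mem_subgroupOf_of_index_two (hU : U.index = 2) {c : absoluteGaloisGroup E} (hcH : c ∈ localSubgroupOfEmb H ι) (hcU : resGalOfEmb ι c ∉ U)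
    (b : H) : Xor (b * (resGalSubgroupOfEmb H ι ⟨c, hcH⟩)⁻¹ ∈ U.subgroupOf H) (b ∈ U.subgroupOf H) := by
  rw [Subgroup.mem_subgroupOf, Subgroup.mem_subgroupOf, Subgroup.coe_mul, Subgroup.coe_inv, resGalSubgroupOfEmb_apply_coe,
    Subgroup.mul_mem_iff_of_index_two hU]
  have hcU' : (resGalOfEmb ι c)⁻¹ ∉ U := fun h ↦ hcU (by simpa using U.inv_mem h)
  by_cases hb : (b : absoluteGaloisGroup k) ∈ U
  · exact Or.inr ⟨hb, fun h ↦ hcU' (h.1 hb)⟩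
  · exact Or.inl ⟨⟨fun h ↦ absurd h hb, fun h ↦ absurd h hcU'⟩, hb⟩

variable [(U.subgroupOf H).Normal]

/-- ★ **The local crossed homomorphism of the transfer on `Λ'`.** If on `Λ' = localSubgroupOfEmb (H ⊓ U) ι` the local crossed homomorphism
`τ ↦ ι_*ξ(res_ι τ)` of `ξ ∈ Z¹(N, E[p^∞])` (`N = U.subgroupOf H`) is the Kummer cocycle `τ ↦ τQ − Q`, then on `Λ'` that of the transfer
`corCocycle ξ ∈ Z¹(H, E[p^∞])` (transversal `{1, c₀}`, `c₀ = res_ι c`) is the Kummer cocycle of the quadratic trace: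
`ι_*(cor ξ)(res_ι τ) = τ(Q + cQ) − (Q + cQ)` — since `(cor ξ)(n) = ξ(n) + c₀·ξ(c₀⁻¹nc₀)` and `c((c⁻¹τc)Q − Q) = τ(cQ) − cQ`.
[cite: NeukirchSchmidtWingberg2008, I §5] [cite: SerreGaloisCohomology1997, I §2.4] -/
theorem pointsMapOfEmb_corCocycle_apply (hN : IsOpen ((U.subgroupOf H : Subgroup H) : Set H))
    (hM : ∀ m : W.geomPrimaryTorsion p, Continuous fun g : H ↦ g • m)
    {c : absoluteGaloisGroup E} (hcH : c ∈ localSubgroupOfEmb H ι)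
    (hc : ∀ b : H, Xor (b * (resGalSubgroupOfEmb H ι ⟨c, hcH⟩)⁻¹ ∈ U.subgroupOf H) (b ∈ U.subgroupOf H))
    (ξ : contOneCocycles (discreteTopRep (U.subgroupOf H) (W.geomPrimaryTorsion p))) (Q : localPoints W E)
    (hξ : ∀ (τ : absoluteGaloisGroup E) (hτ : τ ∈ localSubgroupOfEmb (H ⊓ U) ι),
      pointsMapOfEmb W ι ((ξ.1 ⟨resGalSubgroupOfEmb H ι ⟨τ, localSubgroupOfEmb_inf_le H U ι hτ⟩,
        resGalSubgroupOfEmb_mem_subgroupOf H U ι hτ⟩ : W.geomPrimaryTorsion p) : W.geomPoints) = τ • Q - Q)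
    (τ : absoluteGaloisGroup E) (hτ : τ ∈ localSubgroupOfEmb (H ⊓ U) ι) :
    pointsMapOfEmb W ι (((corCocycle hN hM hc ξ).1 (resGalSubgroupOfEmb H ι ⟨τ, localSubgroupOfEmb_inf_le H U ι hτ⟩) :
        W.geomPrimaryTorsion p) : W.geomPoints) = τ • (Q + c • Q) - (Q + c • Q) := by
  have hτH : τ ∈ localSubgroupOfEmb H ι := localSubgroupOfEmb_inf_le H U ι hτ
  have hτN := resGalSubgroupOfEmb_mem_subgroupOf H U ι hτ
  -- the conjugated element of `N` is the one attached to `c⁻¹ τ c ∈ Λ'`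
  have hconjH : c⁻¹ * τ * c ∈ localSubgroupOfEmb H ι := mul_mem (mul_mem (inv_mem hcH) hτH) hcH
  have e : ((subgroupConj (U.subgroupOf H) (resGalSubgroupOfEmb H ι ⟨c, hcH⟩) ⟨resGalSubgroupOfEmb H ι ⟨τ, hτH⟩, hτN⟩ :
      U.subgroupOf H) : H) = resGalSubgroupOfEmb H ι ⟨c⁻¹ * τ * c, hconjH⟩ := by
    apply Subtype.ext
    rw [subgroupConj_apply_coe, Subgroup.coe_mul, Subgroup.coe_mul, Subgroup.coe_inv, resGalSubgroupOfEmb_apply_coe,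
      resGalSubgroupOfEmb_apply_coe, resGalSubgroupOfEmb_apply_coe, map_mul, map_mul, map_inv]
  have hconj : c⁻¹ * τ * c ∈ localSubgroupOfEmb (H ⊓ U) ι := by
    refine (mem_localSubgroupOfEmb_inf_iff _).2 ⟨hconjH, ?_⟩
    have h2 := (subgroupConj (U.subgroupOf H) (resGalSubgroupOfEmb H ι ⟨c, hcH⟩) ⟨resGalSubgroupOfEmb H ι ⟨τ, hτH⟩, hτN⟩).2
    rw [Subgroup.mem_subgroupOf, e, resGalSubgroupOfEmb_apply_coe] at h2
    exact h2
  have e' : subgroupConj (U.subgroupOf H) (resGalSubgroupOfEmb H ι ⟨c, hcH⟩) ⟨resGalSubgroupOfEmb H ι ⟨τ, hτH⟩, hτN⟩ =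
      ⟨resGalSubgroupOfEmb H ι ⟨c⁻¹ * τ * c, hconjH⟩, resGalSubgroupOfEmb_mem_subgroupOf H U ι hconj⟩ := Subtype.ext e
  -- the value of the transfer on `N`
  have h1 : (corCocycle hN hM hc ξ).1 (resGalSubgroupOfEmb H ι ⟨τ, hτH⟩) =
      ξ.1 ⟨resGalSubgroupOfEmb H ι ⟨τ, hτH⟩, hτN⟩ + resGalSubgroupOfEmb H ι ⟨c, hcH⟩ •
        ξ.1 ⟨resGalSubgroupOfEmb H ι ⟨c⁻¹ * τ * c, hconjH⟩, resGalSubgroupOfEmb_mem_subgroupOf H U ι hconj⟩ := by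
    rw [corCocycle_apply, ← e']
    exact corFun_coe hc ξ ⟨_, hτN⟩
  rw [h1, AddMemClass.coe_add, map_add, primaryComponent.coe_smul, Subgroup.smul_def, resGalSubgroupOfEmb_apply_coe, pointsMapOfEmb_smul,
    hξ τ hτ, hξ _ hconj, smul_sub, ← mul_smul, show c * (c⁻¹ * τ * c) = τ * c by group, mul_smul, smul_add]
  abel

omit [(U.subgroupOf H).Normal] in
/-- `g • (m • x) = m • (g • x)` for the `H`-action on `E[p^∞]`. [folklore] -/
theorem subgroup_smul_nsmul (g : H) (m : ℕ) (x : W.geomPrimaryTorsion p) : g • (m • x) = m • (g • x) :=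
  map_nsmul (DistribSMul.toAddMonoidHom (W.geomPrimaryTorsion p) g) m x

/-- **`p^a` kills the values of the transfer** when it kills the values of `ξ` (`(cor ξ)(n) = ξ(n) + c₀ξ(c₀⁻¹nc₀)`,
`(cor ξ)(nc₀) = (cor ξ)(n) + nξ(c₀²)`). [cite: NeukirchSchmidtWingberg2008, I §5] -/
theorem nsmul_corCocycle_apply_eq_zero (hN : IsOpen ((U.subgroupOf H : Subgroup H) : Set H))
    (hM : ∀ m : W.geomPrimaryTorsion p, Continuous fun g : H ↦ g • m) {c₀ : H}
    (hc : ∀ b : H, Xor (b * c₀⁻¹ ∈ U.subgroupOf H) (b ∈ U.subgroupOf H))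
    (ξ : contOneCocycles (discreteTopRep (U.subgroupOf H) (W.geomPrimaryTorsion p))) {m : ℕ} (hm : ∀ x, m • ξ.1 x = 0) (g : H) :
    m • (corCocycle hN hM hc ξ).1 g = 0 := by
  have hsym : ∀ n : U.subgroupOf H, m • (symCocycle c₀ ξ).1 n = 0 := fun n ↦ by
    rw [symCocycle_apply, smul_add, hm, ← subgroup_smul_nsmul, hm, smul_zero, add_zero]
  rw [corCocycle_apply]
  rcases exists_eq_or_eq_mul hc g with ⟨n, rfl⟩ | ⟨n, rfl⟩
  · rw [corFun_coe, hsym]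
  · rw [corFun_coe_mul, smul_add, hsym, zero_add, ← subgroup_smul_nsmul, hm, smul_zero]

end CorLocal

/-! ## §2 At the layers: `cor ξ` satisfies the signed Kummer condition -/

section Layers

variable {k : Type u} [Field k] [NumberField k] {p : ℕ} [hp : Fact p.Prime] (hp2 : p ≠ 2) (κ : ZpExtension k p)
  (K : Type u) [Field K] [NumberField K] [Algebra k K] (hK2 : Module.finrank k K = 2)
  {E : Type u} [Field E] [Algebra k E] {E' : Type u} [Field E'] [Algebra K E'] [Algebra E E'] [Algebra k E'] [IsScalarTower k K E']
  (ι : AlgebraicClosure k →ₐ[k] AlgebraicClosure E) (ι₂ : AlgebraicClosure E ≃+* AlgebraicClosure E')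
  (ι' : AlgebraicClosure K →ₐ[K] AlgebraicClosure E')
  (hcompat : ∀ z : AlgebraicClosure k, ι' (closureEmb (K := k) K z) = ι₂ (ι z))
  (hι₂ : ∀ a : E, ι₂ (algebraMap E (AlgebraicClosure E) a) = algebraMap E' (AlgebraicClosure E') (algebraMap E E' a))
  (hfixU : ∀ h : absoluteGaloisGroup E, resGalOfEmb ι h ∈ galRange (K := k) K → ∀ y : E',
    (show AlgebraicClosure E ≃ₐ[E] AlgebraicClosure E from h) (ι₂.symm (algebraMap E' (AlgebraicClosure E') y)) =
      ι₂.symm (algebraMap E' (AlgebraicClosure E') y))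
  (hU : (galRange (K := k) K).index = 2) (W : WeierstrassCurve k) (ε : ℤˣ) (n : ℕ)
  [((galRange (K := k) K).subgroupOf (κ.layerSubgroup n)).Normal]

include hι₂ hfixU hU in
/-- ★★ **`cor ξ` satisfies Kobayashi's signed Kummer condition at `ι`.** At layer `n` (`H = κ.layerSubgroup n`, `N = (galRange K).subgroupOf H`,
`c ∈ Λ_n` with `res_ι c ∉ galRange K` the transversal): if `ξ ∈ Z¹(N, E[p^∞])` is killed by `p^a` and on `Λ'_n` its local crossed homomorphism is
the Kummer cocycle of `Q = transportPoints Q_K` with `p^{k'}Q_K ∈ E^ε(K_n·E')`, then `[corCocycle ξ] ∈ localKummerOverOfEmb W p Γ_{k_n} ι (E^ε(k_n·E))`.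
(★ `pointsMapOfEmb_corCocycle_apply` feeds `…E1LocalAtP.mem_localKummerOverOfEmb_signed_of_kummer_trace_witness`.) In INJ (cores route) this is the
condition AT `p` of the `k`-side class `cor ξ_j` (and of `cor([u]ξ_j)` with the `u`-translated witness, B5-pts).
[cite: Kobayashi2003, Def. 1.1] [cite: SerreGaloisCohomology1997, I §2.4] [cite: NeukirchSchmidtWingberg2008, I §5] -/
theorem mem_localKummerOverOfEmb_signed_corCocycle {c : absoluteGaloisGroup E} (hc : c ∈ localSubgroupOfEmb (κ.layerSubgroup n) ι)
    (hcU : resGalOfEmb ι c ∉ galRange (K := k) K)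
    (hN : IsOpen (((galRange (K := k) K).subgroupOf (κ.layerSubgroup n) : Subgroup (κ.layerSubgroup n)) : Set (κ.layerSubgroup n)))
    (hM : ∀ m : W.geomPrimaryTorsion p, Continuous fun g : κ.layerSubgroup n ↦ g • m)
    (ξ : contOneCocycles (discreteTopRep ((galRange (K := k) K).subgroupOf (κ.layerSubgroup n)) (W.geomPrimaryTorsion p)))
    {a : ℕ} (ha : ∀ x, p ^ a • ξ.1 x = 0) (Q_K : localPoints (W.baseChange K) E') (k' : ℕ)
    (hQA : p ^ k' • Q_K ∈ Kobayashi2003.signedLocalPointsOfEmb (κ.restrictOfFinrankEqTwo hp2 K hK2) ι' (W.baseChange K) ε n)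
    (hξ : ∀ (τ : absoluteGaloisGroup E) (hτ : τ ∈ localSubgroupOfEmb (κ.layerSubgroup n ⊓ galRange (K := k) K) ι),
      pointsMapOfEmb W ι ((ξ.1 ⟨resGalSubgroupOfEmb (κ.layerSubgroup n) ι ⟨τ, localSubgroupOfEmb_inf_le _ _ ι hτ⟩,
        resGalSubgroupOfEmb_mem_subgroupOf (κ.layerSubgroup n) (galRange (K := k) K) ι hτ⟩ : W.geomPrimaryTorsion p) : W.geomPoints) =
        τ • transportPoints K ι ι₂ ι' hcompat W Q_K - transportPoints K ι ι₂ ι' hcompat W Q_K) :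
    oneCocycleClass (discreteTopRep (κ.layerSubgroup n) (W.geomPrimaryTorsion p))
        (corCocycle hN hM (xor_mem_subgroupOf_of_index_two (κ.layerSubgroup n) (galRange (K := k) K) ι hU hc hcU) ξ) ∈
      Kobayashi2003.localKummerOverOfEmb W p (κ.layerSubgroup n) ι (Kobayashi2003.signedLocalPointsOfEmb κ ι W ε n) :=
  mem_localKummerOverOfEmb_signed_of_kummer_trace_witness hp2 κ K hK2 ι ι₂ ι' hcompat hι₂ hfixU hU W ε n hc hcU _
    (nsmul_corCocycle_apply_eq_zero W p (κ.layerSubgroup n) (galRange (K := k) K) hN hM _ ξ ha) Q_K k' hQA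
    (fun τ hτ ↦ pointsMapOfEmb_corCocycle_apply W p (κ.layerSubgroup n) (galRange (K := k) K) ι hN hM hc _ ξ _ hξ τ hτ)

include hι₂ hfixU in
/-- The same for the class: `corH1 [ξ] ∈ localKummerOverOfEmb W p Γ_{k_n} ι (E^ε(k_n·E))` (`corH1_oneCocycleClass`).
[cite: Kobayashi2003, Def. 1.1] [cite: SerreGaloisCohomology1997, I §2.4] -/
theorem corH1_mem_localKummerOverOfEmb_signed {c : absoluteGaloisGroup E} (hc : c ∈ localSubgroupOfEmb (κ.layerSubgroup n) ι)
    (hcU : resGalOfEmb ι c ∉ galRange (K := k) K)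
    (hN : IsOpen (((galRange (K := k) K).subgroupOf (κ.layerSubgroup n) : Subgroup (κ.layerSubgroup n)) : Set (κ.layerSubgroup n)))
    (hM : ∀ m : W.geomPrimaryTorsion p, Continuous fun g : κ.layerSubgroup n ↦ g • m)
    (ξ : contOneCocycles (discreteTopRep ((galRange (K := k) K).subgroupOf (κ.layerSubgroup n)) (W.geomPrimaryTorsion p)))
    {a : ℕ} (ha : ∀ x, p ^ a • ξ.1 x = 0) (Q_K : localPoints (W.baseChange K) E') (k' : ℕ)
    (hQA : p ^ k' • Q_K ∈ Kobayashi2003.signedLocalPointsOfEmb (κ.restrictOfFinrankEqTwo hp2 K hK2) ι' (W.baseChange K) ε n)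
    (hξ : ∀ (τ : absoluteGaloisGroup E) (hτ : τ ∈ localSubgroupOfEmb (κ.layerSubgroup n ⊓ galRange (K := k) K) ι),
      pointsMapOfEmb W ι ((ξ.1 ⟨resGalSubgroupOfEmb (κ.layerSubgroup n) ι ⟨τ, localSubgroupOfEmb_inf_le _ _ ι hτ⟩,
        resGalSubgroupOfEmb_mem_subgroupOf (κ.layerSubgroup n) (galRange (K := k) K) ι hτ⟩ : W.geomPrimaryTorsion p) : W.geomPoints) =
        τ • transportPoints K ι ι₂ ι' hcompat W Q_K - transportPoints K ι ι₂ ι' hcompat W Q_K) :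
    corH1 hN hM (xor_mem_subgroupOf_of_index_two (κ.layerSubgroup n) (galRange (K := k) K) ι hU hc hcU)
        (oneCocycleClass (discreteTopRep ((galRange (K := k) K).subgroupOf (κ.layerSubgroup n)) (W.geomPrimaryTorsion p)) ξ) ∈
      Kobayashi2003.localKummerOverOfEmb W p (κ.layerSubgroup n) ι (Kobayashi2003.signedLocalPointsOfEmb κ ι W ε n) := by
  rw [corH1_oneCocycleClass]
  exact mem_localKummerOverOfEmb_signed_corCocycle hp2 κ K hK2 ι ι₂ ι' hcompat hι₂ hfixU hU W ε n hc hcU hN hM ξ ha Q_K k' hQA hξ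

end Layers

end Summit.BirchSwinnertonDyer.BirchSwinnertonDyer.Theorems.SmallImageCharSignedSelmer

end
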